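import Summits.QuantumFields.YangMills.Theorems.UnitScaleTiltProp8ChartQuadratic
import Summits.QuantumFields.YangMills.Theorems.BalabanUVNodesK0FlatCubeOpsTextP
import HarnessLib

/-!
# BalabanUVNodes ∕ N07 — [15] (44)∕(47): THE CHART LETTERS hCd ∕ hCq OF THE MULTI-LEVEL (0.4)-CONSTRAINT IN THE LOGARITHMIC CHART (`Prop8Chart.chartLog η D`, the
# route `UnitScaleTilt`'s pillar P3 `ChartPerLevel`), RE-TYPED GENERIC IN THE CARRIER `P : Params` — so that NODE 00's T⁴ editions are the instances `P := F.P K`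
# (`F : T4Family`), exactly as dag k0-s1-w3's `K0FlatCubeOpsTextP` re-typed the P2 letter schemas

Cell `pub-ymgap`, width seat `pub-ymgap-dag-n07-w2` generation 3 (HUMAN RULING D-0149; DAG node N07 = [15] = [Balaban1985Variational]; W-SEAT START LIST §n07 item 2 =
S2 «[15] Sect. C (47)–(49), Prop. 3 at objects — UST transfer»).  `--kind proof --supports stmt-QuantumFields-20542 --as helper` (K1⁷; count-neutral; theorems only).

WHY.  [15] Sect. F (157) makes «the change of variables `A = A′ − HD(A′)`» of Prop. 3 for the multi-level constraint (156) «`Q_j(ηA) = B` on `Λ′_j`»; Prop. 3's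
fixed point `D(A′)` ((49)–(50)) and its letters (55)∕(57)∕(73) are what the K0 heart consumes (dag k0-s1-w2's bricks 6–8 `K0Stub1SectF{HTermsMultiplierForm,
GradientAssembly,MultiplierFormAnalytic}` DISPLAY `D(A′)` with those letters as hypotheses; dag-n07-e g18 LOCATED-F3 2026-08-28: «for `HD(A₁+HB)`: the H-rows ∘ the
`D(·)` bound of Prop. 3 (S2)»).  The route `UnitScaleTilt` (cell `ym3-torus`) PROVED the inputs of `FlatChart47(Levels).chart47(W)` for the TRUE (0.4) tower of
[Balaban1987RG1] read in the logarithmic chart at background `1` — `Prop8Chart.chartLog η D A (j, c) = (iηLʲ)⁻¹·log Ū^{(j)}(e^{iηA})(c)` on the index set `BondIdx D`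
of a nested family `D : Domains P` ([B6] (2.3)) —: the holomorphy letter hCd and the k-UNIFORM quadratic remainder hCq ((44) «|C_j(LʲηA)| ≤ C₂(Lʲη)²|A|²») on the
WEIGHTED sup-ball of the (115) norms, by a factorised near-flatness induction and the Cauchy estimate along complex lines (`Prop8ChartIterSmall ∕ DiffLocal ∕ Diff ∕
DiffBall ∕ Locality ∕ Quadratic`, seat `ym-ust-19200-p2` g5–g6).  Its ENGINE is generic in `P` and in the fibre algebra `𝔸`; only the five ASSEMBLY theorems
(`weighted_read_bound`, `norm_expCfg_sub_one_le_of_weightedBall`, `differentiableOn_chartLog_weightedBall`, `norm_chartLog_le_weightedBall`,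
`norm_chartLog_sub_fderiv_le_weightedBall`) and `chartRemainder_hCd_hCq` carry the binder `(F : T3Family) (n K : ℕ)` and the literal fibre `M₂(ℂ)` — through the
F4 pen's weights `FlatCubeOpsText.IsLevWeight F n K D w`.  NODE 00's record lives on the T⁴ tori `T4Family.P K` ([Balaban1987RG1] (0.1)); dag k0-s1-w3 re-typed the
weights generic (`K0FlatCubeOpsTextP.IsLevWeight P k D w`, `isLevWeight_iff_T3 : … ↔ FlatCubeOpsText.IsLevWeight F n K D w := Iff.rfl`).  THIS FILE re-proves the six
assembly theorems at `(P : Params) (k : ℕ)` with those weights, `η := (L⁻¹)^k`, fibre ANY complete normed `ℂ`-algebra `𝔸` with `‖1‖ = 1` (so `M_N(ℂ)` for every `N`), by the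
SAME proofs (ported verbatim; every engine lemma cited BY NAME), and reads them at `P := F.P K`.

CONTENTS.  §1 `weighted_read_bound(_of_adm22)` — on the weighted ball the bonds read by a level-`j` index obey `η·Lʲ·‖A b‖ < L·R` (territory level `≥ j − 1`).
§2 `norm_expCfg_sub_one_le_of_weightedBall` (`‖e^{iηA(b)} − 1‖ ≤ 2LR·L^{−j}` there), ★ `differentiableOn_chartLog_weightedBall` (hCd on `{Y | ∀ b, w 1 b·‖Y b‖ < R}`,
`12800ℓ²LR ≤ 1`, `ℓ = (d+2)L`), `norm_chartLog_le_weightedBall` (`‖chartLog η D A (j,c)‖ ≤ 120ℓLR`), `…_of_adm22`.  §3 ★★ `norm_chartLog_sub_fderiv_le_weightedBall` (hCq: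
`‖chartLog η D Y i − (D chartLog(0))Y i‖ ≤ (960ℓL∕R′)·r²` for weighted size `≤ r`, `4r ≤ R′`), ★★ `chartRemainder_hCd_hCq` (both letters, constants `R⋆ := 1∕(12800ℓ²L)`,
`R := R⋆∕4`, `C₂ := 960ℓL∕R⋆`, every (2.2)-admissible family `Adm22 D R′ M` with `2L ≤ R′`, `1 ≤ M`).  §4 `chartRemainder_hCd_hCq_T4` — the instance `P := F.P K`, `F : T4Family`
(any height `k` and family `D : Domains (F.P K)` with `D.k = k`, e.g. dag-n07-e's module 39 `Node00.cubeDomains` with 39b's `Adm22`, or the cube sequence `FlatCubeSequenceAligned.cubeSeqM`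
with `adm22_cubeSeqM`).  The route's own T3 theorems are the instances `P := F.P K`, `k := K − n` of §1–§3 (not restated).

WHAT THIS BUYS ∕ DOES NOT.  With §3 the two `C`-letters of `FlatChart47.chart47` ∕ `FlatChart47Levels.chart47W` (`hCq`, `hCd`) hold AT THE RECORD for the true constraint
map, k-uniformly, constants in `d`, `L` only; the third input hH — a right inverse `H` of the TRUE linearisation `D(chartLog)(0) = η·(Lʲ·Q_j − dΛ_j)` with its weighted
sup bound (46) — is the P2↔P3 bridge (`UnitScaleTiltProp8ChartHInvFromFlatOps ∕ …HInvBridge`, dag k0-s1-w1's flat dictionary + `K0Stub1FlatPropagatorsExistAtRecord` road) and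
is NOT claimed here; `D(A′)` with (55) is then ONE application of `chart47W`.  Reading: the index set `BondIdx D` is print's (2.3) family `D.LamBond` — reading (ii) of
lit-balaban ME #35 (the tree's stub-1 fibre `bondsOf ∘ genSet` = reading (b) awaits the in-place (ii)-edition).  The charted functional is the PLAIN (0.4) tower; dag-n07-e's
LOCATED-BRIDGE-92 (the gauge-dressed `Ũ`) is the plain tower composed with a gauge shear and follows the same template on plan's word.

HONEST FRAMING: a carrier re-typing of kernel theorems of the route `UnitScaleTilt` (proofs ported, credited); the analytic content ([B7] Props. 3–4, the Cauchy estimate)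
is that route's, cited BY NAME; nothing of [15] Sects. D–F asserted; stub 1 ∕ K0⁷ ∕ K1⁷ NOT closed; N07 NOT discharged; counts unmoved (5∕27); one finite T⁴ programme at
fixed ε — NOT continuum ∕ ℝ⁴ ∕ OS ∕ mass gap ∕ Clay: the Yang–Mills mass gap is NOT proved by any of this; R4 closes the conditional rung `BalabanLadder.UV` only.  No `sorry`,
no `def`, no `instance`, no `notation`.

References: [15] T. Bałaban, CMP 102 (1985) 277–309 [Balaban1985Variational] ((44)–(50) p.285, (55) p.286, Prop. 3 p.289, (115) p.295, (152)–(157) pp.301–302); [B7] CMP 98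
(1985) 17–51 [Balaban1985Averaging] (Props. 3–4 pp.36–38); [I] CMP 109 (1987) 249–301 [Balaban1987RG1] ((0.1), (0.4), (0.11) pp.251–253); [B6] CMP 96 (1984) 223–250
[Balaban1984PropagatorsII] ((2.2)–(2.3) p.224).
-/

noncomputable section

open scoped BigOperators
open NormedSpace Metric Set

namespace Summit.QuantumFields.YangMills.BalabanUVNodes.N07ChartRemainderP

open Literature.MathematicalPhysics.QuantumFieldTheory.Balaban1983to89
open Literature.MathematicalPhysics.QuantumFieldTheory.Balaban1983to89.T4Continuum (T4Family)
open Literature.MathematicalPhysics.QuantumFieldTheory.Balaban1983to89.B6SectADomainsV1 (Domains)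
open Literature.MathematicalPhysics.QuantumFieldTheory.Balaban1983to89.B6SectAOperatorsV1 (BondIdx)
open Literature.MathematicalPhysics.QuantumFieldTheory.Balaban1983to89.B5Eq118OneStroke (iterBlockOf)
open Literature.MathematicalPhysics.QuantumFieldTheory.Balaban1983to89.B11Eq115Space (levOf)
open Summit.QuantumFields.YangMills.Theorems.FlatCubeOpsText (Adm22)
open Summit.QuantumFields.YangMills.Theorems.K0FlatCubeOpsTextP (IsLevWeight)
open Summit.QuantumFields.YangMills.Theorems.Prop8Chart (expCfg emlIterU chartLog chartLog_zero differentiableAt_chartLog_zero le_levOf_of_read_succ collar_of_adm22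
  differentiableAt_chartLog_apply_of_reads norm_chartLog_apply_le_of_reads norm_coe_expCfg_sub_one_le differentiableOn_chartLog_of_forall)

variable {P : Params}

/-! ## §1  The weighted ball read through an index bond (generic carrier) -/

section Reads

variable {V : Type*} [SeminormedAddCommGroup V]

/-- **ON THE WEIGHTED BALL, THE BONDS READ BY A LEVEL-`j` INDEX OBEY THE k-UNIFORM LETTER `η·Lʲ·‖A b‖ < L·R`** (`η = L^{−k}`, weights `w 1 b = L^{j(b₋)}·η` of
`K0FlatCubeOpsTextP.IsLevWeight`, collar property): the territory level of a read site is `≥ j − 1`.  Generic-carrier edition of the route `UnitScaleTilt`'s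
`Prop8Chart.weighted_read_bound` (same proof). [cite: Balaban1985Variational, (44)-(48) p.285, (152) p.301; Balaban1984PropagatorsII, (2.2) p.224] -/
theorem weighted_read_bound (k : ℕ) (D : Domains P) (hDk : D.k = k)
    (hcollar : ∀ (i : ℕ) (e : PBond P (i + 1)), D.LamBond (i + 1) e → ∀ z : Site P i, (blockOf z = e.src ∨ blockOf z = e.tgt) → z ∈ D.Om i)
    {w : ℕ → PBond P 0 → ℝ} (hw : IsLevWeight P k D w) {A : PBond P 0 → V} {R : ℝ} (hA : ∀ b, w 1 b * ‖A b‖ < R)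
    (idx : BondIdx D) (b : PBond P 0)
    (hb : iterBlockOf (idx.1.1 : ℕ) b.src = idx.1.2.src ∨ iterBlockOf (idx.1.1 : ℕ) b.src = idx.1.2.tgt) :
    ((P.L : ℝ)⁻¹) ^ k * (P.L : ℝ) ^ (idx.1.1 : ℕ) * ‖A b‖ < (P.L : ℝ) * R := by
  have hL1 : (1 : ℝ) ≤ P.L := by exact_mod_cast P.L_pos
  have hL0 : (0 : ℝ) < P.L := by linarith
  -- the weight of `b` is at least `L^{j-1}·η`
  set lev := levOf (fun i => {y : Site P 0 | D.InOm i y}) D.k b.src with hlev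
  have hlevK : levOf (fun i => {y : Site P 0 | D.InOm i y}) k b.src = lev := by rw [hlev, hDk]
  have hwb : w 1 b = (P.L : ℝ) ^ lev * ((P.L : ℝ)⁻¹) ^ k := by rw [hw 1 b, pow_one, hlevK]
  have hlevj : (idx.1.1 : ℕ) ≤ lev + 1 := by
    rcases Nat.eq_zero_or_eq_succ_pred (idx.1.1 : ℕ) with h0 | hsucc
    · rw [h0]; exact Nat.zero_le _
    · have h := le_levOf_of_read_succ D hcollar idx hsucc b.src hb
      rw [hsucc]
      exact Nat.succ_le_succ h
  have hpow : (P.L : ℝ) ^ (idx.1.1 : ℕ) ≤ (P.L : ℝ) * (P.L : ℝ) ^ lev := by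
    calc (P.L : ℝ) ^ (idx.1.1 : ℕ) ≤ (P.L : ℝ) ^ (lev + 1) := pow_le_pow_right₀ hL1 hlevj
      _ = (P.L : ℝ) * (P.L : ℝ) ^ lev := by rw [pow_succ, mul_comm]
  have hη0 : 0 < ((P.L : ℝ)⁻¹) ^ k := by positivity
  calc ((P.L : ℝ)⁻¹) ^ k * (P.L : ℝ) ^ (idx.1.1 : ℕ) * ‖A b‖
      ≤ ((P.L : ℝ)⁻¹) ^ k * ((P.L : ℝ) * (P.L : ℝ) ^ lev) * ‖A b‖ := by gcongr
    _ = (P.L : ℝ) * (w 1 b * ‖A b‖) := by rw [hwb]; ring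
    _ < (P.L : ℝ) * R := by gcongr; exact hA b

/-- The same with the collar property discharged from (2.2)-admissibility (`2L ≤ R′·M + 1`, `Prop8Chart.collar_of_adm22`). [cite: Balaban1984PropagatorsII, (2.2) p.224; Balaban1985Variational, (152) p.301] -/
theorem weighted_read_bound_of_adm22 (k : ℕ) (D : Domains P) (hDk : D.k = k) {R' M : ℕ} (hAdm : Adm22 D R' M)
    (hRM : 2 * P.L ≤ R' * M + 1)
    {w : ℕ → PBond P 0 → ℝ} (hw : IsLevWeight P k D w) {A : PBond P 0 → V} {R : ℝ} (hA : ∀ b, w 1 b * ‖A b‖ < R)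
    (idx : BondIdx D) (b : PBond P 0)
    (hb : iterBlockOf (idx.1.1 : ℕ) b.src = idx.1.2.src ∨ iterBlockOf (idx.1.1 : ℕ) b.src = idx.1.2.tgt) :
    ((P.L : ℝ)⁻¹) ^ k * (P.L : ℝ) ^ (idx.1.1 : ℕ) * ‖A b‖ < (P.L : ℝ) * R :=
  weighted_read_bound k D hDk (collar_of_adm22 D hAdm hRM) hw hA idx b hb

end Reads

/-! ## §2  hCd: differentiability of the charted constraint on the weighted ball, and the k-uniform sup bound -/

section Weighted

variable {𝔸 : Type*} [NormedRing 𝔸] [NormedAlgebra ℂ 𝔸] [CompleteSpace 𝔸] [NormOneClass 𝔸]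

omit [NormOneClass 𝔸] in
/-- On the weighted ball the charted bond variables read by a level-`j` index are within `2·L·R·L^{−j}` of `1` (`12800ℓ²LR ≤ 1`).  Generic-carrier edition of
`Prop8Chart.norm_expCfg_sub_one_le_of_weightedBall`. [cite: Balaban1985Variational, (152) p.301] -/
theorem norm_expCfg_sub_one_le_of_weightedBall (k : ℕ) (D : Domains P) (hDk : D.k = k)
    (hcollar : ∀ (i : ℕ) (e : PBond P (i + 1)), D.LamBond (i + 1) e → ∀ z : Site P i, (blockOf z = e.src ∨ blockOf z = e.tgt) → z ∈ D.Om i)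
    {w : ℕ → PBond P 0 → ℝ} (hw : IsLevWeight P k D w) {R : ℝ} (hR : 12800 * (((P.d + 2) * P.L : ℕ) : ℝ) ^ 2 * (P.L : ℝ) * R ≤ 1)
    {A : PBond P 0 → 𝔸} (hA : ∀ b, w 1 b * ‖A b‖ < R) (idx : BondIdx D) (b : PBond P 0)
    (hb : iterBlockOf (idx.1.1 : ℕ) b.src = idx.1.2.src ∨ iterBlockOf (idx.1.1 : ℕ) b.src = idx.1.2.tgt) :
    ‖((expCfg (((P.L : ℝ)⁻¹) ^ k) A b : 𝔸ˣ) : 𝔸) - 1‖ ≤ 2 * (P.L : ℝ) * R * ((P.L : ℝ) ^ (idx.1.1 : ℕ))⁻¹ := by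
  have hL1 : (1 : ℝ) ≤ P.L := by exact_mod_cast P.L_pos
  have hL0 : (0 : ℝ) < P.L := by linarith
  have hLj : 0 < (P.L : ℝ) ^ (idx.1.1 : ℕ) := by positivity
  have hread := weighted_read_bound k D hDk hcollar hw hA idx b hb
  set η : ℝ := ((P.L : ℝ)⁻¹) ^ k with hη
  have hη0 : 0 ≤ η := by positivity
  have hηA : η * ‖A b‖ ≤ (P.L : ℝ) * R * ((P.L : ℝ) ^ (idx.1.1 : ℕ))⁻¹ := by
    rw [le_mul_inv_iff₀ hLj]
    calc η * ‖A b‖ * (P.L : ℝ) ^ (idx.1.1 : ℕ) = η * (P.L : ℝ) ^ (idx.1.1 : ℕ) * ‖A b‖ := by ring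
      _ ≤ (P.L : ℝ) * R := hread.le
  have hR1 : (P.L : ℝ) * R ≤ 1 := by
    have h0 : 0 ≤ R := by
      have := hA b
      have hw0 : 0 ≤ w 1 b * ‖A b‖ := by rw [hw 1 b, pow_one]; exact mul_nonneg (by positivity) (norm_nonneg _)
      linarith
    have hℓ1 : (1 : ℝ) ≤ (((P.d + 2) * P.L : ℕ) : ℝ) := by
      exact_mod_cast Nat.one_le_iff_ne_zero.mpr (Nat.mul_ne_zero (by omega) (by have := P.hL.2; omega))
    nlinarith [mul_nonneg (by positivity : (0:ℝ) ≤ (P.L : ℝ)) h0, mul_nonneg (mul_nonneg (by positivity : (0:ℝ) ≤ (((P.d + 2) * P.L : ℕ) : ℝ) ^ 2) hL0.le) h0]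
  have hsmall : ‖((η : ℝ) : ℂ) • A b‖ ≤ 1 := by
    rw [norm_smul, Complex.norm_real, Real.norm_eq_abs, abs_of_nonneg hη0]
    refine hηA.trans ?_
    calc (P.L : ℝ) * R * ((P.L : ℝ) ^ (idx.1.1 : ℕ))⁻¹ ≤ 1 * ((P.L : ℝ) ^ (idx.1.1 : ℕ))⁻¹ := by gcongr
      _ ≤ 1 := by rw [one_mul]; exact inv_le_one_of_one_le₀ (one_le_pow₀ hL1)
  calc _ ≤ 2 * ‖((η : ℝ) : ℂ) • A b‖ := norm_coe_expCfg_sub_one_le η A b hsmall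
    _ = 2 * (η * ‖A b‖) := by rw [norm_smul, Complex.norm_real, Real.norm_eq_abs, abs_of_nonneg hη0]
    _ ≤ 2 * ((P.L : ℝ) * R * ((P.L : ℝ) ^ (idx.1.1 : ℕ))⁻¹) := by gcongr
    _ = 2 * (P.L : ℝ) * R * ((P.L : ℝ) ^ (idx.1.1 : ℕ))⁻¹ := by ring

/-- ★ **hCd, GENERIC CARRIER**: for a nested family `D` with `D.k = k` and the collar property, the weights `K0FlatCubeOpsTextP.IsLevWeight P k D w`, and every radius with
`12800·ℓ²·L·R ≤ 1` (`ℓ = (d+2)L`; k-UNIFORM), the multi-level constraint map `chartLog η D`, `η = L^{−k}`, is ℂ-differentiable on the weighted sup-ball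
`{Y | ∀ b, w 1 b·‖Y b‖ < R}` (engine: `Prop8Chart.differentiableOn_chartLog_of_forall` + `differentiableAt_chartLog_apply_of_reads`; same proof as the route's T3 theorem).
[cite: Balaban1985Variational, (44)-(48) p.285, (156)-(157) p.302; Balaban1985Averaging, Prop. 4 p.38] -/
theorem differentiableOn_chartLog_weightedBall (k : ℕ) (D : Domains P) (hDk : D.k = k)
    (hcollar : ∀ (i : ℕ) (e : PBond P (i + 1)), D.LamBond (i + 1) e → ∀ z : Site P i, (blockOf z = e.src ∨ blockOf z = e.tgt) → z ∈ D.Om i)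
    {w : ℕ → PBond P 0 → ℝ} (hw : IsLevWeight P k D w) {R : ℝ} (hR : 12800 * (((P.d + 2) * P.L : ℕ) : ℝ) ^ 2 * (P.L : ℝ) * R ≤ 1) :
    DifferentiableOn ℂ (chartLog (((P.L : ℝ)⁻¹) ^ k) D : (PBond P 0 → 𝔸) → BondIdx D → 𝔸) {Y | ∀ b, w 1 b * ‖Y b‖ < R} := by
  have hL1 : (1 : ℝ) ≤ P.L := by exact_mod_cast P.L_pos
  have hL0 : (0 : ℝ) < P.L := by linarith
  refine differentiableOn_chartLog_of_forall _ D fun A₀ hA₀ idx => ?_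
  have hLj : 0 < (P.L : ℝ) ^ (idx.1.1 : ℕ) := by positivity
  have hR0 : 0 ≤ R := by
    have := hA₀ (⟨fun _ => 0, idx.1.2.dir⟩ : PBond P 0)
    have hw0 : 0 ≤ w 1 ⟨fun _ => 0, idx.1.2.dir⟩ * ‖A₀ ⟨fun _ => 0, idx.1.2.dir⟩‖ := by
      rw [hw 1, pow_one]; exact mul_nonneg (by positivity) (norm_nonneg _)
    linarith
  set s₀ : ℝ := 2 * (P.L : ℝ) * R * ((P.L : ℝ) ^ (idx.1.1 : ℕ))⁻¹ with hs₀
  have hs₀0 : 0 ≤ s₀ := by positivity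
  have hbudget : 6400 * (((P.d + 2) * P.L : ℕ) : ℝ) ^ 2 * (P.L : ℝ) ^ (idx.1.1 : ℕ) * s₀ ≤ 1 := by
    have : 6400 * (((P.d + 2) * P.L : ℕ) : ℝ) ^ 2 * (P.L : ℝ) ^ (idx.1.1 : ℕ) * s₀ =
        12800 * (((P.d + 2) * P.L : ℕ) : ℝ) ^ 2 * (P.L : ℝ) * R := by
      rw [hs₀]; field_simp; ring
    rw [this]; exact hR
  have hA : ∀ b : PBond P 0, (iterBlockOf (idx.1.1 : ℕ) b.src = idx.1.2.src ∨ iterBlockOf (idx.1.1 : ℕ) b.src = idx.1.2.tgt) →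
      (iterBlockOf (idx.1.1 : ℕ) b.tgt = idx.1.2.src ∨ iterBlockOf (idx.1.1 : ℕ) b.tgt = idx.1.2.tgt) →
      ‖((expCfg (((P.L : ℝ)⁻¹) ^ k) A₀ b : 𝔸ˣ) : 𝔸) - 1‖ ≤ s₀ :=
    fun b hb _ => norm_expCfg_sub_one_le_of_weightedBall k D hDk hcollar hw hR hA₀ idx b hb
  exact (differentiableAt_chartLog_apply_of_reads _ D idx A₀ hs₀0 hbudget hA).1

/-- **THE k-UNIFORM SUP BOUND ON THE WEIGHTED BALL**: `‖chartLog η D A (j, c)‖ ≤ 120ℓ·L·R` at every index, for every `A` in the weighted ball of radius `R`,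
`12800·ℓ²·L·R ≤ 1` (`Prop8Chart.norm_chartLog_apply_le_of_reads`; the input of hCq's Cauchy estimate). [cite: Balaban1985Variational, (44)-(47) p.285] -/
theorem norm_chartLog_le_weightedBall (k : ℕ) (D : Domains P) (hDk : D.k = k)
    (hcollar : ∀ (i : ℕ) (e : PBond P (i + 1)), D.LamBond (i + 1) e → ∀ z : Site P i, (blockOf z = e.src ∨ blockOf z = e.tgt) → z ∈ D.Om i)
    {w : ℕ → PBond P 0 → ℝ} (hw : IsLevWeight P k D w) {R : ℝ} (hR : 12800 * (((P.d + 2) * P.L : ℕ) : ℝ) ^ 2 * (P.L : ℝ) * R ≤ 1)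
    {A : PBond P 0 → 𝔸} (hA : ∀ b, w 1 b * ‖A b‖ < R) (idx : BondIdx D) :
    ‖chartLog (((P.L : ℝ)⁻¹) ^ k) D A idx‖ ≤ 120 * (((P.d + 2) * P.L : ℕ) : ℝ) * (P.L : ℝ) * R := by
  have hL1 : (1 : ℝ) ≤ P.L := by exact_mod_cast P.L_pos
  have hL0 : (0 : ℝ) < P.L := by linarith
  have hLj : 0 < (P.L : ℝ) ^ (idx.1.1 : ℕ) := by positivity
  have hR0 : 0 ≤ R := by
    have := hA (⟨fun _ => 0, idx.1.2.dir⟩ : PBond P 0)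
    have hw0 : 0 ≤ w 1 ⟨fun _ => 0, idx.1.2.dir⟩ * ‖A ⟨fun _ => 0, idx.1.2.dir⟩‖ := by
      rw [hw 1, pow_one]; exact mul_nonneg (by positivity) (norm_nonneg _)
    linarith
  set s₀ : ℝ := 2 * (P.L : ℝ) * R * ((P.L : ℝ) ^ (idx.1.1 : ℕ))⁻¹ with hs₀
  have hs₀0 : 0 ≤ s₀ := by positivity
  have hbudget : 6400 * (((P.d + 2) * P.L : ℕ) : ℝ) ^ 2 * (P.L : ℝ) ^ (idx.1.1 : ℕ) * s₀ ≤ 1 := by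
    have : 6400 * (((P.d + 2) * P.L : ℕ) : ℝ) ^ 2 * (P.L : ℝ) ^ (idx.1.1 : ℕ) * s₀ =
        12800 * (((P.d + 2) * P.L : ℕ) : ℝ) ^ 2 * (P.L : ℝ) * R := by
      rw [hs₀]; field_simp; ring
    rw [this]; exact hR
  have hA' : ∀ b : PBond P 0, (iterBlockOf (idx.1.1 : ℕ) b.src = idx.1.2.src ∨ iterBlockOf (idx.1.1 : ℕ) b.src = idx.1.2.tgt) →
      (iterBlockOf (idx.1.1 : ℕ) b.tgt = idx.1.2.src ∨ iterBlockOf (idx.1.1 : ℕ) b.tgt = idx.1.2.tgt) →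
      ‖((expCfg (((P.L : ℝ)⁻¹) ^ k) A b : 𝔸ˣ) : 𝔸) - 1‖ ≤ s₀ :=
    fun b hb _ => norm_expCfg_sub_one_le_of_weightedBall k D hDk hcollar hw hR hA idx b hb
  have h := norm_chartLog_apply_le_of_reads (((P.L : ℝ)⁻¹) ^ k) D idx A hs₀0 hbudget hA'
  calc _ ≤ 60 * (((P.d + 2) * P.L : ℕ) : ℝ) * (P.L : ℝ) ^ (idx.1.1 : ℕ) * s₀ := h
    _ = 120 * (((P.d + 2) * P.L : ℕ) : ℝ) * (P.L : ℝ) * R := by rw [hs₀]; field_simp; ring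

/-- hCd for EVERY (2.2)-admissible family (`Adm22 D R′ M`, `2L ≤ R′·M + 1`), radius `R ≤ 1∕(12800ℓ²L)`. [cite: Balaban1985Variational, (44)-(48) p.285; Balaban1984PropagatorsII, (2.2) p.224] -/
theorem differentiableOn_chartLog_weightedBall_of_adm22 (k : ℕ) (D : Domains P) (hDk : D.k = k) {R' M : ℕ}
    (hAdm : Adm22 D R' M) (hRM : 2 * P.L ≤ R' * M + 1)
    {w : ℕ → PBond P 0 → ℝ} (hw : IsLevWeight P k D w) {R : ℝ} (hR : 12800 * (((P.d + 2) * P.L : ℕ) : ℝ) ^ 2 * (P.L : ℝ) * R ≤ 1) :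
    DifferentiableOn ℂ (chartLog (((P.L : ℝ)⁻¹) ^ k) D : (PBond P 0 → 𝔸) → BondIdx D → 𝔸) {Y | ∀ b, w 1 b * ‖Y b‖ < R} :=
  differentiableOn_chartLog_weightedBall k D hDk (collar_of_adm22 D hAdm hRM) hw hR

end Weighted

/-! ## §3  hCq: the k-uniform quadratic remainder on the weighted ball (Cauchy estimate), and both letters assembled -/

section Quadratic

variable {𝔸 : Type*} [NormedRing 𝔸] [NormedAlgebra ℂ 𝔸] [CompleteSpace 𝔸] [NormOneClass 𝔸]

/-- ★★ **hCq, GENERIC CARRIER: THE k-UNIFORM QUADRATIC REMAINDER ON THE WEIGHTED BALL.**  For a nested family `D` with `D.k = k` and the collar property, the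
weights `w`, a radius `R′ > 0` with `12800·ℓ²·L·R′ ≤ 1`, and every `Y` with `w 1 b·‖Y b‖ ≤ r` for all `b`, `0 ≤ r`, `4r ≤ R′`:
`‖chartLog η D Y i − (fderiv ℂ (chartLog η D) 0) Y i‖ ≤ (960ℓL∕R′)·r²` at every index `i` (`η = L^{−k}`) — (44) «|C_j(LʲηA)| ≤ C₂(Lʲη)²|A|²» for the TRUE (0.4) tower,
by the Cauchy estimate along the complex line through the weighting isomorphism (`B7TransferAnalyticMean.norm_sub_sub_fderiv_le_of_line`; same proof as the route's T3
theorem). [cite: Balaban1985Variational, (44) p.285, (47)-(48) p.285; Balaban1985Averaging, Prop. 3 (122)-(123) p.36] -/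
theorem norm_chartLog_sub_fderiv_le_weightedBall (k : ℕ) (D : Domains P) (hDk : D.k = k)
    (hcollar : ∀ (i : ℕ) (e : PBond P (i + 1)), D.LamBond (i + 1) e → ∀ z : Site P i, (blockOf z = e.src ∨ blockOf z = e.tgt) → z ∈ D.Om i)
    {w : ℕ → PBond P 0 → ℝ} (hw : IsLevWeight P k D w) {R' : ℝ} (hR' : 12800 * (((P.d + 2) * P.L : ℕ) : ℝ) ^ 2 * (P.L : ℝ) * R' ≤ 1)
    (hR'0 : 0 < R') (Y : PBond P 0 → 𝔸) {r : ℝ} (hr0 : 0 ≤ r) (hr : 4 * r ≤ R') (hY : ∀ b, w 1 b * ‖Y b‖ ≤ r)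
    (i : BondIdx D) :
    ‖chartLog (((P.L : ℝ)⁻¹) ^ k) D Y i -
        (fderiv ℂ (chartLog (((P.L : ℝ)⁻¹) ^ k) D : (PBond P 0 → 𝔸) → BondIdx D → 𝔸) 0) Y i‖ ≤
      960 * (((P.d + 2) * P.L : ℕ) : ℝ) * (P.L : ℝ) / R' * r ^ 2 := by
  -- letters
  set η : ℝ := ((P.L : ℝ)⁻¹) ^ k with hη
  set ℓ : ℝ := (((P.d + 2) * P.L : ℕ) : ℝ) with hℓ
  have hwpos : ∀ b, 0 < w 1 b := fun b => by
    rw [hw 1 b, pow_one]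
    have hL : (0 : ℝ) < P.L := by exact_mod_cast P.L_pos
    positivity
  -- the weighting isomorphism `T Z = (w⁻¹·Z)` and the preimage `Z` of `Y`
  set T : (PBond P 0 → 𝔸) →L[ℂ] (PBond P 0 → 𝔸) :=
    ContinuousLinearMap.pi fun b => ((w 1 b : ℂ)⁻¹) • ContinuousLinearMap.proj (R := ℂ) (φ := fun _ => 𝔸) b with hT
  have hT_apply : ∀ (Z : PBond P 0 → 𝔸) (b : PBond P 0), T Z b = ((w 1 b : ℂ)⁻¹) • Z b := fun Z b => rfl
  set Z : (PBond P 0 → 𝔸) := fun b => (w 1 b : ℂ) • Y b with hZ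
  have hTZ : T Z = Y := by
    funext b
    rw [hT_apply, hZ]
    simp only [smul_smul]
    rw [inv_mul_cancel₀ (by exact_mod_cast (hwpos b).ne'), one_smul]
  have hZnorm : ‖Z‖ ≤ r := by
    refine (pi_norm_le_iff_of_nonneg hr0).2 fun b => ?_
    rw [hZ]; simp only [norm_smul, Complex.norm_real, Real.norm_eq_abs, abs_of_pos (hwpos b)]
    exact hY b
  -- the component map through the weighting
  set g : (PBond P 0 → 𝔸) → 𝔸 := fun A => chartLog η D A i with hg
  set Φ : (PBond P 0 → 𝔸) → 𝔸 := fun X => g (T X) with hΦ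
  have hmaps : ∀ X : PBond P 0 → 𝔸, X ∈ ball (0 : PBond P 0 → 𝔸) R' → ∀ b, w 1 b * ‖T X b‖ < R' := by
    intro X hX b
    rw [mem_ball_zero_iff] at hX
    rw [hT_apply, norm_smul, norm_inv, Complex.norm_real, Real.norm_eq_abs, abs_of_pos (hwpos b), ← mul_assoc,
      mul_inv_cancel₀ (hwpos b).ne', one_mul]
    exact (norm_le_pi_norm X b).trans_lt hX
  have hdiffOn := differentiableOn_chartLog_weightedBall (𝔸 := 𝔸) k D hDk hcollar hw hR'
  have hΦd : DifferentiableOn ℂ Φ (ball (0 : PBond P 0 → 𝔸) R') := by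
    intro X hX
    have hgX : DifferentiableAt ℂ g (T X) := by
      have h := hdiffOn (T X) (hmaps X hX)
      have hopen : IsOpen {Y : PBond P 0 → 𝔸 | ∀ b, w 1 b * ‖Y b‖ < R'} := by
        have : {Y : PBond P 0 → 𝔸 | ∀ b, w 1 b * ‖Y b‖ < R'} = ⋂ b, {Y : PBond P 0 → 𝔸 | w 1 b * ‖Y b‖ < R'} := by ext Y; simp
        rw [this]
        exact isOpen_iInter_of_finite fun b => isOpen_lt (continuous_const.mul (continuous_apply b).norm) continuous_const
      have hd := (h.differentiableAt (hopen.mem_nhds (hmaps X hX)))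
      exact (differentiableAt_pi.mp hd) i
    exact (hgX.comp X T.differentiableAt).differentiableWithinAt
  have hΦB : ∀ X ∈ ball (0 : PBond P 0 → 𝔸) R', ‖Φ X‖ ≤ 120 * ℓ * (P.L : ℝ) * R' := fun X hX =>
    norm_chartLog_le_weightedBall k D hDk hcollar hw hR' (hmaps X hX) i
  -- the Cauchy estimate along the line `t ↦ t•Z`
  have h0 : (0 : PBond P 0 → 𝔸) ∈ ball (0 : PBond P 0 → 𝔸) R' := mem_ball_self hR'0
  have hv : 4 * ‖Z‖ ≤ R' - ‖(0 : PBond P 0 → 𝔸) - 0‖ := by rw [sub_zero, norm_zero, sub_zero]; linarith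
  have hC := B7TransferAnalyticMean.norm_sub_sub_fderiv_le_of_line hΦd hΦB h0 hv
  rw [zero_add, sub_self, norm_zero, sub_zero] at hC
  -- identify the three terms
  have hΦZ : Φ Z = chartLog η D Y i := by rw [hΦ]; simp only [hg]; rw [hTZ]
  have hΦ0 : Φ 0 = 0 := by rw [hΦ]; simp only [hg, map_zero, chartLog_zero, Pi.zero_apply]
  have hdiff0 := differentiableAt_chartLog_zero (P := P) (𝔸 := 𝔸) η D
  have hg0 : DifferentiableAt ℂ g 0 := (differentiableAt_pi.mp hdiff0) i
  have hfd : fderiv ℂ Φ 0 Z = (fderiv ℂ (chartLog η D : (PBond P 0 → 𝔸) → BondIdx D → 𝔸) 0) Y i := by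
    have h1 : fderiv ℂ Φ 0 = (fderiv ℂ g (T 0)).comp T := by
      rw [hΦ]
      exact fderiv_comp 0 (by rw [map_zero]; exact hg0) T.differentiableAt |>.trans (by rw [T.fderiv])
    rw [h1, ContinuousLinearMap.comp_apply, map_zero, hTZ]
    have h2 : fderiv ℂ g 0 = (ContinuousLinearMap.proj (R := ℂ) (φ := fun _ : BondIdx D => 𝔸) i).comp
        (fderiv ℂ (chartLog η D : (PBond P 0 → 𝔸) → BondIdx D → 𝔸) 0) :=
      ((hasFDerivAt_pi'.mp hdiff0.hasFDerivAt) i).fderiv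
    rw [h2, ContinuousLinearMap.comp_apply, ContinuousLinearMap.proj_apply]
  rw [hΦZ, hΦ0, sub_zero, hfd] at hC
  refine hC.trans ?_
  -- `8·(120ℓLR′)·‖Z‖²/R′² ≤ (960ℓL/R′)·r²`
  have hZ2 : ‖Z‖ ^ 2 ≤ r ^ 2 := pow_le_pow_left₀ (norm_nonneg _) hZnorm 2
  have hℓ0 : 0 ≤ ℓ := Nat.cast_nonneg _
  have hL0 : (0 : ℝ) ≤ P.L := Nat.cast_nonneg _
  have heq : 8 * (120 * ℓ * (P.L : ℝ) * R') * ‖Z‖ ^ 2 / R' ^ 2 = 960 * ℓ * (P.L : ℝ) / R' * ‖Z‖ ^ 2 := by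
    rw [div_eq_iff (pow_ne_zero 2 hR'0.ne'), div_mul_eq_mul_div, div_mul_eq_mul_div, eq_div_iff hR'0.ne']
    ring
  rw [heq]
  gcongr

/-- ★★ **hCd ∧ hCq ASSEMBLED, GENERIC CARRIER**, constants in `d` and `L` only: for every `k`, every `R′ ≥ 2L`, `M ≥ 1`, every nested family `D` with `D.k = k`
admissible `Adm22 D R′ M`, and the weights `w`: with `R⋆ := 1∕(12800ℓ²L)`, `R := R⋆∕4`, `C₂ := 960ℓL∕R⋆`, the map `chartLog η D` (`η = L^{−k}`) is ℂ-differentiable on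
the weighted ball of radius `R` and satisfies the quadratic-remainder letter there — the two `C`-inputs `hCd`∕`hCq` of `FlatChart47.chart47` ∕ `chart47W` for the TRUE
constraint; the third (hH) is not claimed. [cite: Balaban1985Variational, (44)-(48) p.285, Prop. 3 p.289] -/
theorem chartRemainder_hCd_hCq (k : ℕ) {R' M : ℕ} (hR'L : 2 * P.L ≤ R') (hM : 1 ≤ M) (D : Domains P) (hDk : D.k = k) (hAdm : Adm22 D R' M)
    {w : ℕ → PBond P 0 → ℝ} (hw : IsLevWeight P k D w) :
    let Rs : ℝ := (12800 * (((P.d + 2) * P.L : ℕ) : ℝ) ^ 2 * (P.L : ℝ))⁻¹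
    DifferentiableOn ℂ (chartLog (((P.L : ℝ)⁻¹) ^ k) D : (PBond P 0 → 𝔸) → BondIdx D → 𝔸) {Y | ∀ b, w 1 b * ‖Y b‖ < Rs / 4} ∧
      ∀ (Y : PBond P 0 → 𝔸) (r : ℝ), r < Rs / 4 → (∀ b, w 1 b * ‖Y b‖ ≤ r) →
        ∀ i : BondIdx D,
          ‖chartLog (((P.L : ℝ)⁻¹) ^ k) D Y i - (fderiv ℂ (chartLog (((P.L : ℝ)⁻¹) ^ k) D : (PBond P 0 → 𝔸) → BondIdx D → 𝔸) 0) Y i‖ ≤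
            (960 * (((P.d + 2) * P.L : ℕ) : ℝ) * (P.L : ℝ) / Rs) * r ^ 2 := by
  intro Rs
  have hL1 : (1 : ℝ) ≤ P.L := by exact_mod_cast P.L_pos
  have hℓ1 : (1 : ℝ) ≤ (((P.d + 2) * P.L : ℕ) : ℝ) := by
    exact_mod_cast Nat.one_le_iff_ne_zero.mpr (Nat.mul_ne_zero (by omega) (by have := P.hL.2; omega))
  have hden : 0 < 12800 * (((P.d + 2) * P.L : ℕ) : ℝ) ^ 2 * (P.L : ℝ) := by positivity
  have hRs0 : 0 < Rs := inv_pos.mpr hden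
  have hRs : 12800 * (((P.d + 2) * P.L : ℕ) : ℝ) ^ 2 * (P.L : ℝ) * Rs ≤ 1 := by
    show 12800 * (((P.d + 2) * P.L : ℕ) : ℝ) ^ 2 * (P.L : ℝ) * (12800 * (((P.d + 2) * P.L : ℕ) : ℝ) ^ 2 * (P.L : ℝ))⁻¹ ≤ 1
    rw [mul_inv_cancel₀ hden.ne']
  have hRs4 : 12800 * (((P.d + 2) * P.L : ℕ) : ℝ) ^ 2 * (P.L : ℝ) * (Rs / 4) ≤ 1 := by
    have : Rs / 4 ≤ Rs := by linarith
    exact le_trans (mul_le_mul_of_nonneg_left this hden.le) hRs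
  have hRM : 2 * P.L ≤ R' * M + 1 := by
    have : R' ≤ R' * M := Nat.le_mul_of_pos_right R' hM
    omega
  have hcollar := collar_of_adm22 D hAdm hRM
  refine ⟨differentiableOn_chartLog_weightedBall k D hDk hcollar hw hRs4, fun Y r hr hY i => ?_⟩
  rcases lt_or_ge r 0 with hneg | hr0
  · exfalso
    have h := hY ⟨fun _ => 0, i.1.2.dir⟩
    have hw0 : 0 ≤ w 1 ⟨fun _ => 0, i.1.2.dir⟩ * ‖Y ⟨fun _ => 0, i.1.2.dir⟩‖ := by
      rw [hw 1, pow_one]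
      have hL : (0 : ℝ) < P.L := by linarith
      exact mul_nonneg (by positivity) (norm_nonneg _)
    linarith
  exact norm_chartLog_sub_fderiv_le_weightedBall k D hDk hcollar hw hRs hRs0 Y hr0 (by linarith) hY i

end Quadratic

/-! ## §4  At NODE 00's record: the T⁴ tori `F.P K` -/

section Record

variable {𝔸 : Type*} [NormedRing 𝔸] [NormedAlgebra ℂ 𝔸] [CompleteSpace 𝔸] [NormOneClass 𝔸]

/-- **AT NODE 00's RECORD**: §3 on the T⁴ torus `F.P K` of a `T4Family` ([Balaban1987RG1] (0.1)), any height `k`, any nested family `D : Domains (F.P K)` with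
`D.k = k` admissible in the sense (2.2), any complete normed `ℂ`-algebra fibre (e.g. `M₂(ℂ)` for stub 1's `SU(2)`). [cite: Balaban1985Variational, (44)-(48) p.285, (157) p.302; Balaban1987RG1, (0.1) p.251] -/
theorem chartRemainder_hCd_hCq_T4 (F : T4Family) (K k : ℕ) {R' M : ℕ} (hR'L : 2 * (F.P K).L ≤ R') (hM : 1 ≤ M) (D : Domains (F.P K))
    (hDk : D.k = k) (hAdm : Adm22 D R' M) {w : ℕ → PBond (F.P K) 0 → ℝ} (hw : IsLevWeight (F.P K) k D w) :
    let Rs : ℝ := (12800 * ((((F.P K).d + 2) * (F.P K).L : ℕ) : ℝ) ^ 2 * ((F.P K).L : ℝ))⁻¹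
    DifferentiableOn ℂ (chartLog ((((F.P K).L : ℝ)⁻¹) ^ k) D : (PBond (F.P K) 0 → 𝔸) → BondIdx D → 𝔸) {Y | ∀ b, w 1 b * ‖Y b‖ < Rs / 4} ∧
      ∀ (Y : PBond (F.P K) 0 → 𝔸) (r : ℝ), r < Rs / 4 → (∀ b, w 1 b * ‖Y b‖ ≤ r) →
        ∀ i : BondIdx D,
          ‖chartLog ((((F.P K).L : ℝ)⁻¹) ^ k) D Y i -
              (fderiv ℂ (chartLog ((((F.P K).L : ℝ)⁻¹) ^ k) D : (PBond (F.P K) 0 → 𝔸) → BondIdx D → 𝔸) 0) Y i‖ ≤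
            (960 * ((((F.P K).d + 2) * (F.P K).L : ℕ) : ℝ) * ((F.P K).L : ℝ) / Rs) * r ^ 2 :=
  chartRemainder_hCd_hCq (P := F.P K) k hR'L hM D hDk hAdm hw

end Record

end Summit.QuantumFields.YangMills.BalabanUVNodes.N07ChartRemainderP

end
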